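import Literature.NumberTheory.Automorphic.WeaklyRegularGaloisRep
import HarnessLib

/-!
# `E_λ`-rational models of the compatible system of a norm-polarized regular algebraic cuspidal
# representation (Barnet-Lamb–Gee–Geraghty–Taylor 2014, Thm. 2.1.1, §5.1 and Lemma 5.3.1 (3))

Topic `Literature/NumberTheory/Automorphic`; companion of `PatrikisTaylorIrreducibility.lean`
(`PatrikisTaylor2014_theorem1_7_goodPrime`: same hypotheses `IsRegularAlgebraic`, the pairing
form `IsEssConjSelfDual π χ` with `χ = ‖·‖_𝔸^m`, and the same attachment clause
`arithFrobPolyOfSatake ι q_v n β` — the C-normalisation `rec(π_v |det|_v^{(1-n)/2})`) and of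
`WeaklyRegularGaloisRep.lean`, `ReciprocityGLn.lean`.  Requested by cite item wi-38105: the typed
named fact `PolarizedCoefficientModels` of the region skeleton `prime-rank-transport` of crux
`IrreducibleOffSector` (route `Langlands/IrreducibilityBySelfDuality`), consumer stub
`K2-applied`; the body below is VERBATIM that Prop with its three abbreviations (`IsAttached`,
`IsPolarizedNorm`, `subfieldEmb`) unfolded, so the skeleton's fact is this one by `exact h`.

## Source and what is printed (held text `paper:arxiv-1010.2561`; final arXiv version read)

T. Barnet-Lamb, T. Gee, D. Geraghty, R. Taylor, *Potential automorphy and change of weight*,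
Ann. of Math. 179 (2014) 501–609 = arXiv:1010.2561 [BarnetlambEtAl2014].

* **Thm. 2.1.1** (§2.1): "Suppose that `(π, χ)` is a regular algebraic, cuspidal, polarized
  automorphic representation of `GL_n(𝔸_F)`. Then there is a continuous semi-simple representation
  `r_{l,ı}(π) : G_F → GL_n(ℚ̄_l)` and an integer `w` with the following properties. … (2) If
  `v ∤ l` is a place of `F` then `ı WD(r_{l,ı}(π)|_{G_{F_v}})^{F-ss} ≅ rec(π_v ⊗ |det|_v^{(1-n)/2})`
  …" — with (§2.1) "polarized": `χ : 𝔸_{F⁺}^×/(F⁺)^× → ℂ^×` continuous with `χ_v(-1)` independent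
  of `v ∣ ∞` (for `F` imaginary `χ_v(-1) = (-1)^n`, "this last condition can always be achieved by
  replacing `μ` by `μ δ_{F/F⁺}`") and `π^c ≅ π^∨ ⊗ (χ ∘ N_{F/F⁺} ∘ det)`.
* **§5.1** (weakly compatible systems `𝓡 = (M, S, {Q_v(X)}, {r_λ}, {H_τ})` defined over a number
  field `M`: for each prime `λ` of `M`, `r_λ : G_F → GL_n(M̄_λ)` continuous semi-simple, unramified
  at `v ∉ S`, `v ∤ l` with `charpoly r_λ(Frob_v) = Q_v(X) ∈ M[X]`; "regular" = every `H_τ`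
  multiplicity-free), closing remark: "if `(π, χ)` is a regular algebraic, cuspidal, polarized
  automorphic representation of `GL_n(𝔸_F)` then … `{r_{l,ı}(π)}` is a strictly pure compatible
  system of weight `w`. (See Theorem 2.1.1.)" — the system
  `𝓡_π = (M_π, S_π, {Q_{π,v}}, {r_{π,λ}}, {H_τ})`, `Q_{π,v} = charpoly rec(π_v |det|_v^{(1-n)/2})`,
  `M_π ⊂ ℂ` a number field, which is REGULAR because `π` is regular algebraic (Thm. 2.1.1 (3): the
  `τ`-Hodge–Tate weights `{a_{ıτ,1}+n-1, …, a_{ıτ,n}}` are distinct); cf. Patrikis–Taylor,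
  Compositio 151 (2015), §1 p. 7: "`𝓡_π` … is a regular, strictly pure compatible system".
* **Lemma 5.3.1 (3)** (numbering of the published version = final arXiv version, §5.3
  "Compatible systems: lemmas"): "If `𝓡` is regular, then after replacing `M` by a finite
  extension we may suppose that for any open subgroup `H ⊂ G_F` and any `λ` and any
  `H`-subrepresentation `s` of `r_λ`, the representation `s` is defined over `𝒪_{M,λ}`."  (Proof:
  regularity and Sen's theorem give Frobenii `Frob_v`, `Frob_{v'}` whose `Q_v`, `Q_{v'}` have `n`
  distinct roots; replace `M` by the splitting field of `Q_v Q_{v'}`; then every `r_λ(G_F)` contains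
  an element with `n` distinct `M_λ`-rational eigenvalues and `tr r_λ ∈ M_λ`, so `r_λ` is
  conjugate into `GL_n(M_λ)` by Lemma 5.3.2 of loc. cit., and into `GL_n(𝒪_{M,λ})` by
  compactness.)  As quoted by C.-Y. Hui, J. London Math. Soc. 108 (2023) = arXiv:2208.04002,
  p. 4: "enlarging `E` to a bigger CM field if necessary, the strictly compatible system can be
  written as a semisimple `E`-rational Serre compatible system `ρ_{π,λ} : Gal_F → GL_n(E_λ)`
  [BLGGT14, Lemma 5.3.1(3)]".

## Rendering and faithfulness

* `K` CM (`NumberField.IsCMField K`); `π : CuspidalAutomorphicRepData n K hcpt` regular algebraic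
  (`IsRegularAlgebraic`) and POLARIZED UP TO A NORM POWER: `∃ χ m, (∀ x, χ x = ‖x‖^m) ∧
  π.1.IsEssConjSelfDual χ` — as in `PatrikisTaylorIrreducibility.lean`, whose module docstring
  explains why such `π` ARE polarizable in [BLGGT]'s sense (`‖·‖_{𝔸_K}^m = ‖·‖_{𝔸_{K⁺}}^m ∘ N_{K/K⁺}`,
  sign condition met by `χ₀ = ‖·‖^m · ε_{K/K⁺}^n`).  The `E_λ`-model statement is printed ONLY
  for (polarizable, hence) REGULAR compatible systems; it is NOT vendored for general regular
  algebraic `π`.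
* ATTACHED at `(ℓ, ι)`: `r : Γ_K → GL_n(ℚ̄_ℓ)` semisimple and, at every finite `v ∤ ℓ` where `π` has
  a Satake parameter `β`, unramified with arithmetic-Frobenius characteristic polynomial
  `arithFrobPolyOfSatake ι q_v n β` (= `ı⁻¹` of the reciprocal polynomial of `Q_{π,v}`; the tree's
  reviewed convention of `ReciprocityGLn`, verbatim the clause of
  `PatrikisTaylor2014_theorem1_7_goodPrime`).
* INDEXING.  [BLGGT] index the system by the primes `λ` of `M`; the typed form indexes by
  `(ℓ, ι : ℚ̄_ℓ ≃ ℂ)`.  This is a reparametrisation: `ι⁻¹|_E : E ↪ ℚ̄_ℓ` induces a prime `λ ∣ ℓ` of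
  `E` and identifies the completion `E_λ` with the CLOSURE of `ι⁻¹(E)` in `ℚ̄_ℓ` (a closed
  subfield); `r_λ : G_K → GL_n(𝒪_{E,λ})` transported along an `E_λ`-embedding `Ē_λ ≃ ℚ̄_ℓ` is
  attached to `(π, ι)` (its Frobenius polynomials are the `ι⁻¹(Q_{π,v})`, `Q_{π,v} ∈ M_π[X] ⊆ E[X]`)
  and has all its matrix entries in that closure.  So the conclusion below — ONE number field
  `E ⊂ ℂ` (`Subfield ℂ`, finite over `ℚ`; namely the finite extension of `M_π` of Lemma 5.3.1 (3),
  embedded in `ℂ` over `M_π ⊂ ℂ`) such that at EVERY `(ℓ, ι)` SOME attached `r` has all entries in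
  `closure (ι⁻¹(E))` — is the printed statement, bundled with the existence of the attached system
  (Thm. 2.1.1), exactly as the sibling fact bundles it with Patrikis–Taylor's Thm. 1.7.

## References

* [BarnetlambEtAl2014] Ann. of Math. 179 (2014): §2.1 (polarized; Thm. 2.1.1), §5.1 (weakly
  compatible systems; `{r_{l,ı}(π)}` is a strictly pure compatible system), §5.3 Lemma 5.3.1 (3)
  and Lemma 5.3.2 (descent to `M_λ`); arXiv:1010.2561 (final version).
* [PatrikisTaylor2014] Compositio Math. 151 (2015), §1 p. 7 (`𝓡_π` is a regular, strictly pure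
  compatible system over `M_π`).
* C.-Y. Hui, *Monodromy of subrepresentations and irreducibility of low degree automorphic Galois
  representations*, J. London Math. Soc. 108 (2023) = arXiv:2208.04002, p. 4 (the quotation above).
-/

noncomputable section

open scoped NumberField
open NumberField IsDedekindDomain Filter

namespace Literature.NumberTheory.Automorphic

open Literature.NumberTheory.GaloisRepresentations (HeckeCharacter ideleGroup ideleNorm FramedGaloisRep)

/-- **Barnet-Lamb–Gee–Geraghty–Taylor 2014: the compatible system of a norm-polarized regular
algebraic cuspidal `π` over a CM field has `E_λ`-rational members for ONE number field `E`
(Thm. 2.1.1 with §5.1 and Lemma 5.3.1 (3)).**  Let `K` be a CM number field and `π` a REGULAR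
ALGEBRAIC cuspidal automorphic representation of `GL_n(𝔸_K)` which is POLARIZED UP TO A NORM
POWER (`π^c ≅ π^∨ ⊗ (χ ∘ det)` in the tree's pairing form `IsEssConjSelfDual π χ`, `χ = ‖·‖_𝔸^m`;
hence polarizable in the sense of [BLGGT] §2.1).  Then there is a number field `E ⊂ ℂ` such that
for EVERY prime `ℓ` and EVERY `ι : ℚ̄_ℓ ≃ ℂ` SOME `r : Γ_K → GL_n(ℚ̄_ℓ)` attached to `(π, ι)` —
semisimple, and at every finite `v ∤ ℓ` where `π` has Satake parameter `β` unramified with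
arithmetic-Frobenius characteristic polynomial `arithFrobPolyOfSatake ι q_v n β` — has ALL its
matrix entries in the closure of `ι⁻¹(E)` in `ℚ̄_ℓ` (`= E_λ` for the prime `λ ∣ ℓ` of `E` induced
by `ι⁻¹`).  Printed: Thm. 2.1.1 (existence of the semisimple `r_{l,ı}(π)` with
`ı WD(r|_{G_{F_v}})^{F-ss} ≅ rec(π_v ⊗ |det|_v^{(1-n)/2})` at `v ∤ l`), §5.1 ("`{r_{l,ı}(π)}` is a
strictly pure compatible system", regular as `π` is regular algebraic) and Lemma 5.3.1 (3) ("If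
`𝓡` is regular, then after replacing `M` by a finite extension we may suppose that … for any `λ`
… `r_λ` … is defined over `𝒪_{M,λ}`"); the `(ℓ, ι)`-indexing is the reparametrisation described
in the module docstring.  VERBATIM the region-skeleton Prop `PolarizedCoefficientModels` of crux
`IrreducibleOffSector` with `IsAttached` / `IsPolarizedNorm` / `subfieldEmb` unfolded.  Named fact
(D-0014); users take `(h : BLGGT2014_polarized_compatibleSystem_rationalModels)`.
[cite: BarnetlambEtAl2014, Thm. 2.1.1, §5.1 and Lemma 5.3.1 (3)]
[cite: PatrikisTaylor2014, §1 p. 7 (the compatible system `𝓡_π`)] -/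
def BLGGT2014_polarized_compatibleSystem_rationalModels : Prop :=
  ∀ (n : ℕ) (K : Type) [Field K] [NumberField K] [IsCMField K]
    (hcpt : isCompact_glFiniteIntegralLevel n K) (π : CuspidalAutomorphicRepData n K hcpt),
      π.1.IsRegularAlgebraic →
      (∃ (χ : HeckeCharacter K) (m : ℤ),
          (∀ x : ideleGroup K, ((χ x : ℂˣ) : ℂ) = (ideleNorm x : ℂ) ^ (m : ℂ)) ∧
            π.1.IsEssConjSelfDual χ) →
        ∃ E : Subfield ℂ, FiniteDimensional ℚ E ∧
          ∀ (ℓ : ℕ) [Fact ℓ.Prime] (ι : PadicAlgCl ℓ ≃+* ℂ),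
            ∃ r : FramedGaloisRep K (PadicAlgCl ℓ) n,
              (r.toGaloisRep.IsSemisimple ∧
                ∀ (v : HeightOneSpectrum (𝓞 K)) (β : Multiset ℂ), π.1.HasSatakeParamAt v β →
                  ((ℓ : ℕ) : 𝓞 K) ∉ v.asIdeal →
                    r.IsUnramifiedAt v ∧
                      r.HasFrobCharpolyAt v (arithFrobPolyOfSatake ι v.residueCard n β)) ∧
              ∀ (g : Field.absoluteGaloisGroup K) (i j : Fin n),
                ((r g : GL (Fin n) (PadicAlgCl ℓ)) : Matrix (Fin n) (Fin n) (PadicAlgCl ℓ)) i j ∈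
                  closure (Set.range
                    ((ι.symm : ℂ ≃+* PadicAlgCl ℓ).toRingHom.comp E.subtype))

/-- Hypothesis form: given the fact, a regular algebraic, norm-polarized cuspidal `π` on `GL_n/K`,
`K` CM, has a number field `E ⊂ ℂ` of coefficients such that at every `(ℓ, ι)` some attached `r`
is `E_λ`-valued. [cite: BarnetlambEtAl2014, Lemma 5.3.1 (3)] -/
theorem BLGGT2014_polarized_compatibleSystem_rationalModels.apply
    (h : BLGGT2014_polarized_compatibleSystem_rationalModels)
    {n : ℕ} {K : Type} [Field K] [NumberField K] [IsCMField K]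
    {hcpt : isCompact_glFiniteIntegralLevel n K} (π : CuspidalAutomorphicRepData n K hcpt)
    (hra : π.1.IsRegularAlgebraic) {χ : HeckeCharacter K} {m : ℤ}
    (hχ : ∀ x : ideleGroup K, ((χ x : ℂˣ) : ℂ) = (ideleNorm x : ℂ) ^ (m : ℂ))
    (hpol : π.1.IsEssConjSelfDual χ) :
    ∃ E : Subfield ℂ, FiniteDimensional ℚ E ∧
      ∀ (ℓ : ℕ) [Fact ℓ.Prime] (ι : PadicAlgCl ℓ ≃+* ℂ),
        ∃ r : FramedGaloisRep K (PadicAlgCl ℓ) n,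
          (r.toGaloisRep.IsSemisimple ∧
            ∀ (v : HeightOneSpectrum (𝓞 K)) (β : Multiset ℂ), π.1.HasSatakeParamAt v β →
              ((ℓ : ℕ) : 𝓞 K) ∉ v.asIdeal →
                r.IsUnramifiedAt v ∧
                  r.HasFrobCharpolyAt v (arithFrobPolyOfSatake ι v.residueCard n β)) ∧
          ∀ (g : Field.absoluteGaloisGroup K) (i j : Fin n),
            ((r g : GL (Fin n) (PadicAlgCl ℓ)) : Matrix (Fin n) (Fin n) (PadicAlgCl ℓ)) i j ∈
              closure (Set.range ((ι.symm : ℂ ≃+* PadicAlgCl ℓ).toRingHom.comp E.subtype)) :=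
  h n K hcpt π hra ⟨χ, m, hχ, hpol⟩

end Literature.NumberTheory.Automorphic

end
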